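import Literature.MathematicalPhysics.QuantumFieldTheory.Balaban1983to89.DagBinding
import Literature.MathematicalPhysics.QuantumFieldTheory.Balaban1983to89.B14

/-!
# K1 — RUN-WISE LETTERS FROM β-BOXES (generic `β : HBeta`): the residue-free home of the five small lemmas the N24 engine v2 reads (dag-n24-c g20, ENGINE-v2 DESIGN §3 (a)),
# as GENERALISED statements — two-sided ∕ asymmetric boxes, the SHARP recentred run remainder, level-0 letters in `∀ᶠ` form, (2.6) CONSTRUCTION-FREE along a raw run, and the
# DAG leaf `FlowStepPrinted` CLASS-FREE at any `WorldP`

Cell `pub-ymgap`, width seat `pub-ymgap-dag-n07-w3` (g17; N07 [B11] ∕ K0⁷–K1 junction).  `--kind proof --supports stmt-QuantumFields-27364 --as helper`, COUNT-NEUTRAL.  NEW leaf;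
theorems only — 0 `def`, 0 `sorry`, 0 `instance`, 0 `notation`.  ROUTE-INDEPENDENT, RESIDUE-FREE and SEAM-INDEPENDENT: imports ONLY `Literature/…/DagBinding` (`WorldP`, `leavesP`,
`CurriesHBeta`, `rgEqH_of_curries`; through it `FlowStep`'s `Box ∕ box_mono ∕ RGEqH ∕ BetaUpperH ∕ BetaLowerH ∕ inv_sq_telescopeH` and `Step.InInterval`) and `Literature/…/B14` (`FlowIneq26`)
— 51 modules in the import closure, NONE of them on the Stage-2 seam's cone (`Node00/Record13CoP` is NOT below this file), so it is green before, during and after the campaign.  Every run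
letter is stated UNFOLDED (the `∀ n gs, RGEqH n β gs → Step.InInterval γ₀ n gs → ∀ k ≤ n, …` shape), i.e. DEFINITIONALLY DEF-1's `RunConstRemainder β b r γ₀` (`Thm/…K2NamedJetsRunRemAt`, whose
closure does sit above the seam) — a consumer holding ∕ wanting that token passes the terms across by `exact` (δ-unfolding); the green K1 v6 adapters `…K1RunRowsOfBoxAndPartialSums.
runConstRemainder_of_twoSided_alongRuns ∕ runConstRemainder_of_boxBounds` and `…K1EndOfNodes13PWSOfRunRemAt.frequently_betaZero_le_of_runConstRemainder` are the named bridges (CITED,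
not imported, to keep this file off the seam's cone).  [I] = [Balaban1987RG1]; [III] = [Balaban1988Convergent]; [II′] = [Balaban1989LargeFieldII].

WHY.  dag-n24-c g20's decl-level census (HOME `pub-ymgap-dag-n24-c/N24-G20-ENGINE-V2-DESIGN.md` §3, bus 2026-08-30 I.18531): after the seam the K1 face's abstract-witness ∕ certificate ∕
engine modules consume from the nine residue chain modules exactly FIVE small lemmas with clean statements — `runConstRemainder_zero_of_boxH` (`…PSFloorWorldBuilt`), `runwiseCeiling_of_betaUpperH`
and `frequently_betaZero_le_of_runwiseCeiling` (`…Flow26LettersWorldBuilt`), `flowStepPrinted_leavesP_of_ceiling_noShrinkG` (`…P2CMixedWNoShrinkWorldBuiltG`), `windowLetters_of_absBetaBoxH`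
(`…N24K1ConsequentOfStubsV19AndChildren`).  A verbatim public copy bounces `dedup.landed`; this file states each in a STRICTLY MORE GENERAL form (the residue statement is a one-line instance),
so engine v2 ((b) the CLASS-S editions of `…AtAbstractWitness(Y0)`, (c) the ᴮ siblings) imports ONE green module for all five.

CONTENTS (RESIDUE-SHAPED DROP-INS for n24-c's CLASS-S editions, bus I.18807: `windowLetters_of_absBoxH` · `runCeiling_of_betaUpperH` · `exists_frequently_betaZero_le_of_runCeiling`; the two
cone-side ones — `runConstRemainder_zero_of_boxH` in DEF-1's token and the S∕G-class `flowStepPrinted_leavesP_of_ceiling_noShrink(G)` — follow in the cone-side companion `…K1RunwiseLettersOfBoxHAtRecord`).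
§0 window arithmetic with NO sign hypothesis (`exists_window_letters_twoSided`) and the ASYMMETRIC box transport keeping `γ ≤ γ₀` (`windowLetters_of_boxH`; abs instance
`windowLetters_of_absBoxH'`).  §1 boxes ⟹ run-wise letters along every solution of (0.20) staying in `]0, γ₀]`, `γ₀ ≤ γ`: `runTwoSided_of_boxH` (floor ∧ ceiling), `runCeiling_of_betaUpperH_all` ∕
`runFloor_of_betaLowerH_all` (one-sided, every level at once), `runMidRemainder_of_boxH` (SHARP: centre `(bₗ+β′)∕2`, radius `(β′−bₗ)∕2`; UNFOLDED `RunConstRemainder`), `runAbs_of_absBoxH`,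
`runTwoSided_of_runRemainder`.  §2 run-wise
ceiling ⟹ level-0 letters: `betaZero_le_of_runCeiling` (pointwise on `]0, γ₀]`), `eventually_betaZero_le_of_runCeiling` (`∀ᶠ x in 𝓝[>] 0`), `exists_frequently_betaZero_le_of_levelZero` (the
window criterion's input from a pointwise level-0 bound ALONE), `exists_frequently_betaZero_le_of_runRemainder` (from an UNFOLDED run remainder; = the K1 END road's `frequently_betaZero_le_of_runConstRemainder` in DEF-1's token).  §3 (2.6) CONSTRUCTION-FREE along a raw run `gs` (`inv_sq_le_add_of_rgEqH_of_runCeiling`, `flow26Upper_of_rgEqH_of_runCeiling`,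
`flowIneq26_of_rgEqH_of_runCeiling_noShrink`; NO sign on the ceiling), the construction edition `flowIneq26_run_of_curries_of_runCeiling_noShrink`, and the CLASS-FREE DAG leaf
`flowStepPrinted_leavesP_of_runLetters (w : WorldP)` (S-∕G-∕any-class records = instances through their own `rgFlow_of_smallCouplings_…`).

HONEST FRAMING (binding).  Elementary real bookkeeping about the tree's own predicates (`FlowStep.Box ∕ BetaUpperH ∕ BetaLowerH ∕ RGEqH`, `Step.InInterval`, DEF-1's `RunConstRemainder`,
`B14.FlowIneq26`, `Dag.FlowStepPrinted`); NO β estimate — every box ∕ ceiling ∕ no-shrink letter is a DISPLAYED HYPOTHESIS (NODE O's wall: [I] §1 p.264 «uniformly bounded» stated, proof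
unpublished, [II′] p.355); nothing of Bałaban's asserted; K0⁷ (stmt-QuantumFields-20541) ∕ K1⁹ (27364) ∕ K3⁸ (27366) NOT closed; N07 ∕ N24 NOT discharged; counts UNMOVED (typed 28∕28 ·
discharged 8∕28, route display 8∕27 excl. NODE O; K 1∕4 — the chair's words); R4 = the CONDITIONAL finite-𝕋⁴ rung `BalabanLadder.UV` at fixed `ε = L^(−K)` only — NOT continuum ∕ ℝ⁴ ∕ OS;
the Yang–Mills mass gap (Clay) is NOT proved by any of this.  Standard axioms only.
-/

noncomputable section

open Filter Topology

namespace Summit.QuantumFields.YangMills.Theorems.K1RunwiseLettersOfBoxH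

open Literature.MathematicalPhysics.QuantumFieldTheory.Balaban1983to89
open Literature.MathematicalPhysics.QuantumFieldTheory.Balaban1983to89.FlowStep
open Literature.MathematicalPhysics.QuantumFieldTheory.Balaban1983to89.DagBinding (WorldP leavesP CurriesHBeta rgEqH_of_curries)

/-! ## §0  Window arithmetic with NO sign, and the ASYMMETRIC box transport keeping `γ ≤ γ₀` -/

/-- **WINDOW ARITHMETIC, NO SIGN**: for ANY reals `bₗ, β′` and `γ₀ > 0` there is `γ ∈ ]0, γ₀]`, `γ ≤ ½`, with BOTH letters `−bₗ·γ² ≤ 3` and `β′·γ² ≤ ¾`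
(`γ := min γ₀ (min ½ (1 + |bₗ| + |β′|)⁻¹)`; then `|β′|·γ ≤ 1`, `|bₗ|·γ ≤ 1`).  Generalises `Record13SignFreeComparabilityOfBetaBox.exists_window_letters_signFree` (`bₗ = −β′`, `0 ≤ β′`).
The arithmetic behind «γ sufficiently small». [cite: Balaban1987RG1, Thm 1 p.259, §1 p.264 (bookkeeping)] -/
theorem exists_window_letters_twoSided (bl β' : ℝ) {γ₀ : ℝ} (hγ0 : 0 < γ₀) :
    ∃ γ : ℝ, 0 < γ ∧ γ ≤ γ₀ ∧ γ ≤ 1 / 2 ∧ -bl * γ ^ 2 ≤ 3 ∧ β' * γ ^ 2 ≤ 3 / 4 := by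
  have hD : (0 : ℝ) < 1 + |bl| + |β'| := by positivity
  have h1 : (0 : ℝ) < 1 / (1 + |bl| + |β'|) := div_pos one_pos hD
  set γ := min γ₀ (min (1 / 2) (1 / (1 + |bl| + |β'|))) with hγdef
  have hγ0' : 0 < γ := lt_min hγ0 (lt_min (by norm_num) h1)
  have h2 : γ ≤ 1 / 2 := (min_le_right _ _).trans (min_le_left _ _)
  have h3 : γ ≤ 1 / (1 + |bl| + |β'|) := (min_le_right _ _).trans (min_le_right _ _)
  have hγD : γ * (1 + |bl| + |β'|) ≤ 1 := by
    have := mul_le_mul_of_nonneg_right h3 hD.le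
    rwa [one_div, inv_mul_cancel₀ hD.ne'] at this
  have hbγ : |β'| * γ ≤ 1 := by nlinarith [abs_nonneg bl, abs_nonneg β', hγ0'.le]
  have hlγ : |bl| * γ ≤ 1 := by nlinarith [abs_nonneg bl, abs_nonneg β', hγ0'.le]
  refine ⟨γ, hγ0', min_le_left _ _, h2, ?_, ?_⟩
  · have hle : -bl * γ ^ 2 ≤ |bl| * γ ^ 2 := mul_le_mul_of_nonneg_right (neg_le_abs bl) (sq_nonneg γ)
    have : |bl| * γ ^ 2 ≤ 1 * (1 / 2) := by
      have e : |bl| * γ ^ 2 = (|bl| * γ) * γ := by ring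
      rw [e]; exact mul_le_mul hlγ h2 hγ0'.le zero_le_one
    linarith
  · have hle : β' * γ ^ 2 ≤ |β'| * γ ^ 2 := mul_le_mul_of_nonneg_right (le_abs_self β') (sq_nonneg γ)
    have : |β'| * γ ^ 2 ≤ 1 * (1 / 2) := by
      have e : |β'| * γ ^ 2 = (|β'| * γ) * γ := by ring
      rw [e]; exact mul_le_mul hbγ h2 hγ0'.le zero_le_one
    linarith

/-- **ASYMMETRIC BOX ⟹ SHRUNK WINDOW WITH BOTH LETTERS, `γ ≤ γ₀` KEPT** (any `β : HBeta`, any reals `bₗ, β′`): `bₗ ≤ β ≤ β′` on the boxes `]0, γ₀]^(k+1)`, `γ₀ > 0` ⟹ some `γ ∈ ]0, γ₀]`,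
`γ ≤ ½`, with `−bₗ·γ² ≤ 3`, `β′·γ² ≤ ¾` and the same box on `]0, γ]^(k+1)` (`FlowStep.box_mono`).  The residue `windowLetters_of_absBetaBoxH` is the instance `bₗ := −β′` (minus the kept `γ ≤ γ₀`).
[cite: Balaban1987RG1, Thm 1 p.259, §1 p.264 (bookkeeping)] -/
theorem windowLetters_of_boxH {β : HBeta} {γ₀ bl β' : ℝ} (hγ0 : 0 < γ₀) (hlow : BetaLowerH bl γ₀ β) (hup : BetaUpperH β' γ₀ β) :
    ∃ γ : ℝ, 0 < γ ∧ γ ≤ γ₀ ∧ γ ≤ 1 / 2 ∧ -bl * γ ^ 2 ≤ 3 ∧ β' * γ ^ 2 ≤ 3 / 4 ∧ BetaLowerH bl γ β ∧ BetaUpperH β' γ β := by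
  obtain ⟨γ, hγpos, hγle, hγhalf, hl, hu⟩ := exists_window_letters_twoSided bl β' hγ0
  exact ⟨γ, hγpos, hγle, hγhalf, hl, hu, fun k v hv => hlow k v (box_mono hγle k hv), fun k v hv => hup k v (box_mono hγle k hv)⟩

/-- The abs instance WITH `γ ≤ γ₀` kept: `−β′ ≤ β ≤ β′` on `]0, γ₀]` ⟹ a shrunk window `γ ≤ min γ₀ ½` carrying `−(−β′)·γ² ≤ 3`, `β′·γ² ≤ ¾` and the abs box. [cite: Balaban1987RG1, Thm 1 p.259, §1 p.264 (bookkeeping)] -/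
theorem windowLetters_of_absBoxH' {β : HBeta} {γ₀ β' : ℝ} (hγ0 : 0 < γ₀) (hlow : BetaLowerH (-β') γ₀ β) (hup : BetaUpperH β' γ₀ β) :
    ∃ γ : ℝ, 0 < γ ∧ γ ≤ γ₀ ∧ γ ≤ 1 / 2 ∧ -(-β') * γ ^ 2 ≤ 3 ∧ β' * γ ^ 2 ≤ 3 / 4 ∧ BetaLowerH (-β') γ β ∧ BetaUpperH β' γ β :=
  windowLetters_of_boxH hγ0 hlow hup

/-- **RESIDUE-SHAPED INSTANCE (drop-in for `…N24K1ConsequentOfStubsV19AndChildren.windowLetters_of_absBetaBoxH`, 7-tuple `⟨γ, hγpos, hγh, hl, hu, hlow', hup'⟩`)**: the abs box on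
`]0, γ₀]` ⟹ a window `γ ≤ ½` with `−(−β′)·γ² ≤ 3`, `β′·γ² ≤ ¾` and the abs box there. [cite: Balaban1987RG1, Thm 1 p.259, §1 p.264 (bookkeeping)] -/
theorem windowLetters_of_absBoxH {β : HBeta} {γ₀ β' : ℝ} (hγ0 : 0 < γ₀) (hlow : BetaLowerH (-β') γ₀ β) (hup : BetaUpperH β' γ₀ β) :
    ∃ γ : ℝ, 0 < γ ∧ γ ≤ 1 / 2 ∧ -(-β') * γ ^ 2 ≤ 3 ∧ β' * γ ^ 2 ≤ 3 / 4 ∧ BetaLowerH (-β') γ β ∧ BetaUpperH β' γ β := by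
  obtain ⟨γ, hγpos, -, hγhalf, hl, hu, hlow', hup'⟩ := windowLetters_of_boxH hγ0 hlow hup
  exact ⟨γ, hγpos, hγhalf, hl, hu, hlow', hup'⟩

/-! ## §1  Boxes ⟹ run-wise letters along every solution of (0.20) staying in `]0, γ₀]` (generic `β : HBeta`) -/

section RunLetters

variable {β : HBeta} {bl β' γ γ₀ : ℝ}

/-- **LEVEL TRANSPORT OF AN UPPER BOX**: `β ≤ β′` on `]0, γ]^(k+1)` ⟹ the same on `]0, γ₀]^(k+1)` for `γ₀ ≤ γ` (`FlowStep.box_mono`). [cite: Balaban1987RG1, §1 p.264 (bookkeeping)] -/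
theorem betaUpperH_of_le (hhi : BetaUpperH β' γ β) (hle : γ₀ ≤ γ) : BetaUpperH β' γ₀ β :=
  fun k v hv => hhi k v (box_mono hle k hv)

/-- **LEVEL TRANSPORT OF A LOWER BOX**: `bₗ ≤ β` on `]0, γ]^(k+1)` ⟹ the same on `]0, γ₀]^(k+1)` for `γ₀ ≤ γ`. [cite: Balaban1987RG1, §1 p.264 (bookkeeping)] -/
theorem betaLowerH_of_le (hlo : BetaLowerH bl γ β) (hle : γ₀ ≤ γ) : BetaLowerH bl γ₀ β :=
  fun k v hv => hlo k v (box_mono hle k hv)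

/-- Along a `]0, γ₀]`-sequence up to `n` (`Step.InInterval γ₀ n gs`), every prefix `(g_0,…,g_k)`, `k ≤ n`, lies in the box `]0, γ]^(k+1)` of any level `γ ≥ γ₀`. [cite: Balaban1987RG1, Thm 3 p.264 (bookkeeping)] -/
theorem prefixOf_mem_box_of_stepInInterval_le {n k : ℕ} {gs : ℕ → ℝ} (hI : Step.InInterval γ₀ n gs) (hle : γ₀ ≤ γ) (hk : k ≤ n) :
    prefixOf gs k ∈ Box γ k :=
  mem_box.mpr fun i => ⟨(hI i ((Nat.le_of_lt_succ i.isLt).trans hk)).1, (hI i ((Nat.le_of_lt_succ i.isLt).trans hk)).2.trans hle⟩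

/-- **BOX ⟹ RUN-WISE FLOOR ∧ CEILING** at every level `γ₀ ≤ γ`: `bₗ ≤ β_k ≤ β′` on `]0, γ]^(k+1)` ⟹ along every solution of (0.20) up to `n` staying in `]0, γ₀]`, every `β_k(g_0,…,g_k)`,
`k ≤ n`, lies in `[bₗ, β′]`.  (The `RGEqH` hypothesis is carried for the run currency only; the letters need the window alone.) [cite: Balaban1987RG1, Thm 3 p.264, (1.22) p.264 (bookkeeping)] -/
theorem runTwoSided_of_boxH (hlo : BetaLowerH bl γ β) (hhi : BetaUpperH β' γ β) (hle : γ₀ ≤ γ) :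
    ∀ (n : ℕ) (gs : ℕ → ℝ), RGEqH n β gs → Step.InInterval γ₀ n gs → ∀ k, k ≤ n → bl ≤ β k (prefixOf gs k) ∧ β k (prefixOf gs k) ≤ β' :=
  fun _ _ _ hI k hk =>
    ⟨hlo k _ (prefixOf_mem_box_of_stepInInterval_le hI hle hk), hhi k _ (prefixOf_mem_box_of_stepInInterval_le hI hle hk)⟩

/-- **UPPER BOX ⟹ RUN-WISE CEILING AT EVERY LEVEL `γ₀ ≤ γ` AT ONCE** (the residue `runwiseCeiling_of_betaUpperH` is the instance at one `γ₀`). [cite: Balaban1987RG1, (1.22) p.264, Thm 3 p.264 (bookkeeping)] -/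
theorem runCeiling_of_betaUpperH_all (hhi : BetaUpperH β' γ β) :
    ∀ γ₀ : ℝ, γ₀ ≤ γ → ∀ (n : ℕ) (gs : ℕ → ℝ), RGEqH n β gs → Step.InInterval γ₀ n gs → ∀ k, k ≤ n → β k (prefixOf gs k) ≤ β' :=
  fun _ hle _ _ _ hI k hk => hhi k _ (prefixOf_mem_box_of_stepInInterval_le hI hle hk)

/-- **RESIDUE-SHAPED INSTANCE (drop-in for `…Flow26LettersWorldBuilt.runwiseCeiling_of_betaUpperH`)**: the run-wise ceiling at ONE level `γ₀ ≤ γ`. [cite: Balaban1987RG1, (1.22) p.264, Thm 3 p.264 (bookkeeping)] -/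
theorem runCeiling_of_betaUpperH (hhi : BetaUpperH β' γ β) (hle : γ₀ ≤ γ) :
    ∀ (n : ℕ) (gs : ℕ → ℝ), RGEqH n β gs → Step.InInterval γ₀ n gs → ∀ k, k ≤ n → β k (prefixOf gs k) ≤ β' :=
  runCeiling_of_betaUpperH_all hhi γ₀ hle

/-- The run-wise floor at ONE level `γ₀ ≤ γ` (floor twin of the previous instance). [cite: Balaban1987RG1, (1.22) p.264, Thm 3 p.264 (bookkeeping)] -/
theorem runFloor_of_betaLowerH (hlo : BetaLowerH bl γ β) (hle : γ₀ ≤ γ) :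
    ∀ (n : ℕ) (gs : ℕ → ℝ), RGEqH n β gs → Step.InInterval γ₀ n gs → ∀ k, k ≤ n → bl ≤ β k (prefixOf gs k) :=
  fun _ _ _ hI k hk => hlo k _ (prefixOf_mem_box_of_stepInInterval_le hI hle hk)

/-- **LOWER BOX ⟹ RUN-WISE FLOOR AT EVERY LEVEL `γ₀ ≤ γ` AT ONCE.** [cite: Balaban1987RG1, (1.22) p.264, Thm 3 p.264 (bookkeeping)] -/
theorem runFloor_of_betaLowerH_all (hlo : BetaLowerH bl γ β) :
    ∀ γ₀ : ℝ, γ₀ ≤ γ → ∀ (n : ℕ) (gs : ℕ → ℝ), RGEqH n β gs → Step.InInterval γ₀ n gs → ∀ k, k ≤ n → bl ≤ β k (prefixOf gs k) :=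
  fun _ hle _ _ _ hI k hk => hlo k _ (prefixOf_mem_box_of_stepInInterval_le hI hle hk)

/-- **BOX ⟹ THE SHARP RECENTRED RUN REMAINDER** at every level `γ₀ ≤ γ`: `bₗ ≤ β ≤ β′` on `]0, γ]` ⟹ along runs in `]0, γ₀]`, `|β_k(g_0,…,g_k) − (bₗ+β′)∕2| ≤ (β′−bₗ)∕2` — reference the
MIDPOINT, radius HALF THE WIDTH; UNFOLDED, i.e. `RunConstRemainder β (fun _ ↦ (bₗ+β′)∕2) ((β′−bₗ)∕2) γ₀` by `rfl` (the green K1 v6 adapter `runConstRemainder_of_boxBounds` is the `γ₀ = γ` case in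
that token; the residue `runConstRemainder_zero_of_boxH` has reference `0`, radius `max β′ (−bₗ)`). [cite: Balaban1987RG1, Thm 3 p.264, (1.22) p.264, (5.10) p.293 (bookkeeping)] -/
theorem runMidRemainder_of_boxH (hlo : BetaLowerH bl γ β) (hhi : BetaUpperH β' γ β) (hle : γ₀ ≤ γ) :
    ∀ (n : ℕ) (gs : ℕ → ℝ), RGEqH n β gs → Step.InInterval γ₀ n gs → ∀ k, k ≤ n → |β k (prefixOf gs k) - (bl + β') / 2| ≤ (β' - bl) / 2 := by
  intro n gs hrg hI k hk
  obtain ⟨h1, h2⟩ := runTwoSided_of_boxH hlo hhi hle n gs hrg hI k hk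
  rw [abs_le]
  constructor <;> linarith

/-- **ABS BOX ⟹ `|β| ≤ β′` ALONG RUNS** at every level `γ₀ ≤ γ` (g16's `K0V23Stub3RunwiseSuppliers.runAbsBound_of_absBox` is the `γ₀ = γ` case). [cite: Balaban1987RG1, Thm 3 p.264, (1.22) p.264, (5.10) p.293 (bookkeeping)] -/
theorem runAbs_of_absBoxH (hlo : BetaLowerH (-β') γ β) (hhi : BetaUpperH β' γ β) (hle : γ₀ ≤ γ) :
    ∀ (n : ℕ) (gs : ℕ → ℝ), RGEqH n β gs → Step.InInterval γ₀ n gs → ∀ k, k ≤ n → |β k (prefixOf gs k)| ≤ β' := by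
  intro n gs hrg hI k hk
  obtain ⟨h1, h2⟩ := runTwoSided_of_boxH hlo hhi hle n gs hrg hI k hk
  exact abs_le.mpr ⟨h1, h2⟩

/-- A run remainder with reference `b` and radius `r` (UNFOLDED `RunConstRemainder β b r γ₀`; pass DEF-1's token by `exact`) IS a run-wise floor `b_k − r` and ceiling `b_k + r`
(for consumers reading the two letters separately). [cite: Balaban1987RG1, Thm 3 p.264 (bookkeeping)] -/
theorem runTwoSided_of_runRemainder {b : ℕ → ℝ} {r : ℝ}
    (h : ∀ (n : ℕ) (gs : ℕ → ℝ), RGEqH n β gs → Step.InInterval γ₀ n gs → ∀ k, k ≤ n → |β k (prefixOf gs k) - b k| ≤ r) :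
    ∀ (n : ℕ) (gs : ℕ → ℝ), RGEqH n β gs → Step.InInterval γ₀ n gs → ∀ k, k ≤ n → b k - r ≤ β k (prefixOf gs k) ∧ β k (prefixOf gs k) ≤ b k + r := by
  intro n gs hrg hI k hk
  have habs := abs_le.mp (h n gs hrg hI k hk)
  constructor <;> linarith [habs.1, habs.2]

end RunLetters

/-! ## §2  Run-wise ceiling ⟹ level-0 letters (the window criterion's input) -/

section LevelZero

variable {β : HBeta} {B γ₀ : ℝ}

/-- **RUN-WISE CEILING ⟹ POINTWISE LEVEL-0 BOUND ON `]0, γ₀]`**: the one-point run `(x)`, `0 < x ≤ γ₀`, is a solution of (0.20) up to `n = 0` in the window, so `β_0(x) ≤ B`.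
[cite: Balaban1987RG1, (0.17)–(0.20) pp.255–256, §1 p.264 (elementary)] -/
theorem betaZero_le_of_runCeiling
    (h : ∀ (n : ℕ) (gs : ℕ → ℝ), RGEqH n β gs → Step.InInterval γ₀ n gs → ∀ k, k ≤ n → β k (prefixOf gs k) ≤ B)
    {x : ℝ} (hx0 : 0 < x) (hx : x ≤ γ₀) : β 0 (fun _ => x) ≤ B := by
  have hRG : RGEqH 0 β (fun _ => x) := fun k hk => absurd hk (Nat.not_lt_zero k)
  have hI : Step.InInterval γ₀ 0 (fun _ => x) := fun _ _ => ⟨hx0, hx⟩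
  have h1 := h 0 (fun _ => x) hRG hI 0 le_rfl
  have e : prefixOf (fun _ : ℕ => x) 0 = fun _ => x := rfl
  rw [e] at h1
  exact h1

/-- **RUN-WISE CEILING ⟹ `β_0 ≤ B` EVENTUALLY AS `g → 0⁺`** (`∀ᶠ x in 𝓝[>] 0` — stronger than the residue's `∃ᶠ`). [cite: Balaban1987RG1, (0.17)–(0.20) pp.255–256, §1 p.264 (elementary)] -/
theorem eventually_betaZero_le_of_runCeiling (hγ₀ : 0 < γ₀)
    (h : ∀ (n : ℕ) (gs : ℕ → ℝ), RGEqH n β gs → Step.InInterval γ₀ n gs → ∀ k, k ≤ n → β k (prefixOf gs k) ≤ B) :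
    ∀ᶠ x in 𝓝[>] (0 : ℝ), β 0 (fun _ => x) ≤ B := by
  have hlt : ∀ᶠ x in 𝓝[>] (0 : ℝ), x < γ₀ := (eventually_lt_nhds hγ₀).filter_mono nhdsWithin_le_nhds
  have hpos : ∀ᶠ x in 𝓝[>] (0 : ℝ), 0 < x := eventually_mem_nhdsWithin
  filter_upwards [hlt, hpos] with x hx hx0
  exact betaZero_le_of_runCeiling h hx0 hx.le

/-- **A POINTWISE LEVEL-0 BOUND ON `]0, γ₀]` ALONE PAYS THE WINDOW CRITERION's INPUT** `∃ b, ∃ᶠ x in 𝓝[>] 0, β_0(x) ≤ b` (dag-n13-w4's `window_of_frequently_beta_le`); the residue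
`frequently_betaZero_le_of_runwiseCeiling` is this ∘ `betaZero_le_of_runCeiling`. [cite: Balaban1987RG1, (0.17)–(0.20) pp.255–256, §1 p.264 (elementary)] -/
theorem exists_frequently_betaZero_le_of_levelZero (hγ₀ : 0 < γ₀) (h : ∀ x : ℝ, 0 < x → x ≤ γ₀ → β 0 (fun _ => x) ≤ B) :
    ∃ b : ℝ, ∃ᶠ x in 𝓝[>] (0 : ℝ), β 0 (fun _ => x) ≤ b := by
  have hlt : ∀ᶠ x in 𝓝[>] (0 : ℝ), x < γ₀ := (eventually_lt_nhds hγ₀).filter_mono nhdsWithin_le_nhds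
  have hpos : ∀ᶠ x in 𝓝[>] (0 : ℝ), 0 < x := eventually_mem_nhdsWithin
  have hev : ∀ᶠ x in 𝓝[>] (0 : ℝ), β 0 (fun _ => x) ≤ B := by
    filter_upwards [hlt, hpos] with x hx hx0
    exact h x hx0 hx.le
  exact ⟨B, hev.frequently⟩

/-- **RESIDUE-SHAPED INSTANCE (drop-in for `…Flow26LettersWorldBuilt.frequently_betaZero_le_of_runwiseCeiling`)**: the run-wise ceiling on `]0, γ₀]`, `γ₀ > 0` ⟹ the window criterion's
input `∃ b, ∃ᶠ x in 𝓝[>] 0, β_0(x) ≤ b` (= `exists_frequently_betaZero_le_of_levelZero ∘ betaZero_le_of_runCeiling`). [cite: Balaban1987RG1, (0.17)–(0.20) pp.255–256, §1 p.264 (elementary)] -/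
theorem exists_frequently_betaZero_le_of_runCeiling (hγ₀ : 0 < γ₀)
    (h : ∀ (n : ℕ) (gs : ℕ → ℝ), RGEqH n β gs → Step.InInterval γ₀ n gs → ∀ k, k ≤ n → β k (prefixOf gs k) ≤ B) :
    ∃ b : ℝ, ∃ᶠ x in 𝓝[>] (0 : ℝ), β 0 (fun _ => x) ≤ b :=
  exists_frequently_betaZero_le_of_levelZero hγ₀ fun _ hx0 hx => betaZero_le_of_runCeiling h hx0 hx

/-- **A RUN REMAINDER (DEF-1's currency, UNFOLDED) ⟹ THE WINDOW CRITERION's INPUT**: `|β_k − b_k| ≤ r` along `]0, γ₀]`-runs gives `∃ b, ∃ᶠ x in 𝓝[>] 0, β_0(x) ≤ b` (with `b := b_0 + r`;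
the green K1 END road's `frequently_betaZero_le_of_runConstRemainder` is the same sentence in the `RunConstRemainder` token). [cite: Balaban1987RG1, (0.17)–(0.20) pp.255–256, §1 p.264 (elementary)] -/
theorem exists_frequently_betaZero_le_of_runRemainder (hγ₀ : 0 < γ₀) {b : ℕ → ℝ} {r : ℝ}
    (h : ∀ (n : ℕ) (gs : ℕ → ℝ), RGEqH n β gs → Step.InInterval γ₀ n gs → ∀ k, k ≤ n → |β k (prefixOf gs k) - b k| ≤ r) :
    ∃ b' : ℝ, ∃ᶠ x in 𝓝[>] (0 : ℝ), β 0 (fun _ => x) ≤ b' :=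
  exists_frequently_betaZero_le_of_levelZero (B := b 0 + r) hγ₀ fun x hx0 hx => by
    have hRG : RGEqH 0 β (fun _ => x) := fun k hk => absurd hk (Nat.not_lt_zero k)
    have hI : Step.InInterval γ₀ 0 (fun _ => x) := fun _ _ => ⟨hx0, hx⟩
    have h1 := (abs_le.mp (h 0 (fun _ => x) hRG hI 0 le_rfl)).2
    have e : prefixOf (fun _ : ℕ => x) 0 = fun _ => x := rfl
    rw [e] at h1
    linarith

end LevelZero

/-! ## §3  (2.6) CONSTRUCTION-FREE along a raw run, the construction edition, and the CLASS-FREE DAG leaf `FlowStepPrinted` -/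

section Flow26

variable {β : HBeta} {B β₀ γ₀ : ℝ}

/-- **TELESCOPED (0.20) UNDER A RUN-WISE CEILING, RAW RUN**: `RGEqH n β gs`, `gs` in `]0, γ₀]` up to `n`, `β_k(g_0,…,g_k) ≤ B` for `k ≤ n` ⟹ `1∕g_m² ≤ 1∕g_{n′}² + B·(n′ − m)` for `m ≤ n′ ≤ n`
(`FlowStep.inv_sq_telescopeH` + the ceiling summand by summand; NO sign on `B`). [cite: Balaban1987RG1, (0.20) p.256, Thm 3 p.264 (elementary)] -/
theorem inv_sq_le_add_of_rgEqH_of_runCeiling {n : ℕ} {gs : ℕ → ℝ} (hrg : RGEqH n β gs)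
    (hceil : ∀ k, k ≤ n → β k (prefixOf gs k) ≤ B) {m n' : ℕ} (hmn : m ≤ n') (hn' : n' ≤ n) :
    1 / (gs m) ^ 2 ≤ 1 / (gs n') ^ 2 + B * ((n' : ℝ) - m) := by
  rw [inv_sq_telescopeH hrg hmn hn']
  have hsum : ∑ j ∈ Finset.Ico m n', β j (prefixOf gs j) ≤ ∑ _j ∈ Finset.Ico m n', B :=
    Finset.sum_le_sum fun j hj => hceil j ((Finset.mem_Ico.mp hj).2.le.trans hn')
  have hcard : ∑ _j ∈ Finset.Ico m n', B = B * ((n' : ℝ) - m) := by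
    rw [Finset.sum_const, Nat.card_Ico, nsmul_eq_mul, Nat.cast_sub hmn]; ring
  linarith

/-- **(2.6), FIRST MEMBER, CONSTRUCTION-FREE**: along a raw run `gs` (`RGEqH n β gs`, `Step.InInterval γ₀ n gs`) under the run-wise ceiling `β_k ≤ B`, `k ≤ n`:
`g_{n′} ≤ (1 + g_{n′}²·B·(n′−m))^{1∕2}·g_m` for `m < n′ ≤ n` — NO sign on `B` (the factor is non-negative BECAUSE the squared inequality holds with positive couplings; n24-w1's
`flow26_upper_of_rg_upper` is the `Setup.Flow` reading). [cite: Balaban1988Convergent, (2.6) p.255; Balaban1987RG1, (0.20) p.256] -/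
theorem flow26Upper_of_rgEqH_of_runCeiling {n : ℕ} {gs : ℕ → ℝ} (hrg : RGEqH n β gs) (hI : Step.InInterval γ₀ n gs)
    (hceil : ∀ k, k ≤ n → β k (prefixOf gs k) ≤ B) :
    ∀ m n', m < n' → n' ≤ n → gs n' ≤ Real.sqrt (1 + (gs n') ^ 2 * B * ((n' : ℝ) - m)) * gs m := by
  intro m n' hmn hn'
  have hm : 0 < gs m := (hI m (hmn.le.trans hn')).1
  have hn : 0 < gs n' := (hI n' hn').1
  have key := inv_sq_le_add_of_rgEqH_of_runCeiling hrg hceil hmn.le hn'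
  have hsq : (gs n') ^ 2 ≤ (1 + (gs n') ^ 2 * B * ((n' : ℝ) - m)) * (gs m) ^ 2 := by
    have hm2 : 0 < (gs m) ^ 2 := by positivity
    have hn2 : 0 < (gs n') ^ 2 := by positivity
    rw [div_le_iff₀ hm2] at key
    have h2 : (gs n') ^ 2 * 1 ≤ (gs n') ^ 2 * ((1 / (gs n') ^ 2 + B * ((n' : ℝ) - m)) * (gs m) ^ 2) :=
      mul_le_mul_of_nonneg_left key hn2.le
    have h3 : (gs n') ^ 2 * ((1 / (gs n') ^ 2 + B * ((n' : ℝ) - m)) * (gs m) ^ 2) = (1 + (gs n') ^ 2 * B * ((n' : ℝ) - m)) * (gs m) ^ 2 := by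
      field_simp
    linarith [h2, h3]
  have hfac : 0 ≤ 1 + (gs n') ^ 2 * B * ((n' : ℝ) - m) := by
    by_contra hneg
    have : (1 + (gs n') ^ 2 * B * ((n' : ℝ) - m)) * (gs m) ^ 2 < 0 := mul_neg_of_neg_of_pos (lt_of_not_ge hneg) (by positivity)
    nlinarith [sq_nonneg (gs n')]
  calc gs n' = Real.sqrt ((gs n') ^ 2) := (Real.sqrt_sq hn.le).symm
    _ ≤ Real.sqrt ((1 + (gs n') ^ 2 * B * ((n' : ℝ) - m)) * (gs m) ^ 2) := Real.sqrt_le_sqrt hsq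
    _ = Real.sqrt (1 + (gs n') ^ 2 * B * ((n' : ℝ) - m)) * gs m := by rw [Real.sqrt_mul hfac, Real.sqrt_sq hm.le]

/-- **[III] (2.6) CONSTRUCTION-FREE ALONG A RAW RUN** from the run-wise ceiling (first member) and the run-wise no-shrink letter (last member, verbatim) — `B14.FlowIneq26 gs B β₀ n`.
[cite: Balaban1988Convergent, (2.6) p.255; Balaban1987RG1, (0.20) p.256] -/
theorem flowIneq26_of_rgEqH_of_runCeiling_noShrink {n : ℕ} {gs : ℕ → ℝ} (hrg : RGEqH n β gs) (hI : Step.InInterval γ₀ n gs)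
    (hceil : ∀ k, k ≤ n → β k (prefixOf gs k) ≤ B) (hmul : ∀ m n', m < n' → n' ≤ n → gs m ≤ (1 + β₀) * gs n') :
    B14.FlowIneq26 gs B β₀ n :=
  fun m n' hmn hn' => ⟨flow26Upper_of_rgEqH_of_runCeiling hrg hI hceil m n' hmn hn', hmul m n' hmn hn'⟩

/-- The run of a construction currying `β` that satisfies (0.20) and stays in `]0, γ]`, `γ ≤ γ₀`, IS a raw run in the window: `RGEqH` (`DagBinding.rgEqH_of_curries`) ∧ `Step.InInterval γ₀`.
[cite: Balaban1987RG1, (0.20) p.256, §5 p.298 (bookkeeping)] -/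
theorem rgEqH_and_stepInInterval_of_run (C : B12.Construction) (β : HBeta) (hcur : CurriesHBeta C β) {γ γ₀ : ℝ} (hγ : γ ≤ γ₀) (P : B12.RunParams)
    (hrg : (C P).flow.SatisfiesRG P.K) (hI : (C P).flow.InInterval γ P.K) :
    RGEqH P.K β (C P).flow.g ∧ Step.InInterval γ₀ P.K (C P).flow.g :=
  ⟨rgEqH_of_curries C β hcur P hrg, fun k hk => ⟨(hI k hk).1, (hI k hk).2.trans hγ⟩⟩

/-- **(2.6) ALONG ONE RUN OF A CONSTRUCTION CURRYING `β`** from the two RUN-WISE letters on a level `γ₀ ≥` the run's window `γ` — the construction edition of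
`flowIneq26_of_rgEqH_of_runCeiling_noShrink` (the residue `flowIneq26_alongRun_of_ceiling_noShrink` routes the first member through `Setup.Flow`; same content).
[cite: Balaban1988Convergent, (2.6) p.255; Balaban1987RG1, (0.20) p.256, §5 p.298] -/
theorem flowIneq26_run_of_curries_of_runCeiling_noShrink (C : B12.Construction) (β : HBeta) (hcur : CurriesHBeta C β) {γ : ℝ} (hγ : γ ≤ γ₀)
    (hceil : ∀ (n : ℕ) (gs : ℕ → ℝ), RGEqH n β gs → Step.InInterval γ₀ n gs → ∀ k, k ≤ n → β k (prefixOf gs k) ≤ B)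
    (hmul : ∀ (n : ℕ) (gs : ℕ → ℝ), RGEqH n β gs → Step.InInterval γ₀ n gs → ∀ m n', m < n' → n' ≤ n → gs m ≤ (1 + β₀) * gs n')
    (P : B12.RunParams) (hrg : (C P).flow.SatisfiesRG P.K) (hI : (C P).flow.InInterval γ P.K) :
    B14.FlowIneq26 (C P).flow.g B β₀ P.K := by
  obtain ⟨hRG, hIs⟩ := rgEqH_and_stepInInterval_of_run C β hcur hγ P hrg hI
  exact flowIneq26_of_rgEqH_of_runCeiling_noShrink hRG hIs (hceil P.K _ hRG hIs) (hmul P.K _ hRG hIs)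

/-- **★ THE DAG LEAF `Dag.FlowStepPrinted` AT ANY `WorldP`, CLASS-FREE** — from: the world's construction curries `β` (`CurriesHBeta w.C.toB12 β`), (0.20) along the run whenever the
couplings are small (`smallCouplings → rgFlow`, the record classes' `rgFlow_of_smallCouplings_of_isRecordOfRecord₁₃CSepCoPH{S,G}`), and the two RUN-WISE letters at the world's own
`(βup, β₀)` on a level `γ₀ ≥ w.γ`.  The residue S-∕G-class lemmas `flowStepPrinted_leavesP_of_ceiling_noShrink(G)` are the instances `β := D.βfun`, `hcur := D.curries`, `hC : w.C = D.C`.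
CONDITIONAL; closes nothing. [cite: Balaban1988Convergent, (2.6) p.255, Cor. 3 (2.50) p.264; Balaban1989LargeFieldII, Thm 1 + (0.1) pp.355–356; Balaban1987RG1, (0.20) p.256, §1 p.264 (bookkeeping)] -/
theorem flowStepPrinted_leavesP_of_runLetters (w : WorldP) {β : HBeta} (hcur : CurriesHBeta w.C.toB12 β) (P : B12.RunParams)
    (hrg : (leavesP w P).smallCouplings → (leavesP w P).rgFlow) (hγ : w.γ ≤ γ₀)
    (hceil : ∀ (n : ℕ) (gs : ℕ → ℝ), RGEqH n β gs → Step.InInterval γ₀ n gs → ∀ k, k ≤ n → β k (prefixOf gs k) ≤ w.βup)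
    (hmul : ∀ (n : ℕ) (gs : ℕ → ℝ), RGEqH n β gs → Step.InInterval γ₀ n gs → ∀ m n', m < n' → n' ≤ n → gs m ≤ (1 + w.β₀) * gs n') :
    Dag.FlowStepPrinted (leavesP w P) := by
  intro hsc
  have hrgP : (w.C.toB12 P).flow.SatisfiesRG P.K := hrg hsc
  have hsc' : (w.C.toB12 P).flow.InInterval w.γ P.K := hsc
  exact flowIneq26_run_of_curries_of_runCeiling_noShrink w.C.toB12 β hcur hγ hceil hmul P hrgP hsc'

/-- **The DAG leaf from a β-BOX and the no-shrink letter** (box ⟹ ceiling by §1): `β ≤ βup` on `]0, γ]^(k+1)`, `w.γ ≤ γ₀ ≤ γ`, + no-shrink on level `γ₀` ⟹ `Dag.FlowStepPrinted (leavesP w P)`.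
CONDITIONAL; closes nothing. [cite: Balaban1988Convergent, (2.6) p.255; Balaban1987RG1, (0.20) p.256, (1.22) p.264, Thm 3 p.264 (bookkeeping)] -/
theorem flowStepPrinted_leavesP_of_betaUpperH_noShrink (w : WorldP) {β : HBeta} (hcur : CurriesHBeta w.C.toB12 β) (P : B12.RunParams)
    (hrg : (leavesP w P).smallCouplings → (leavesP w P).rgFlow) {γ : ℝ} (hγ : w.γ ≤ γ₀) (hle : γ₀ ≤ γ) (hhi : BetaUpperH w.βup γ β)
    (hmul : ∀ (n : ℕ) (gs : ℕ → ℝ), RGEqH n β gs → Step.InInterval γ₀ n gs → ∀ m n', m < n' → n' ≤ n → gs m ≤ (1 + w.β₀) * gs n') :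
    Dag.FlowStepPrinted (leavesP w P) :=
  flowStepPrinted_leavesP_of_runLetters w hcur P hrg hγ (runCeiling_of_betaUpperH_all hhi γ₀ hle) hmul

end Flow26

end Summit.QuantumFields.YangMills.Theorems.K1RunwiseLettersOfBoxH

end
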